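import Mathlib.AlgebraicGeometry.EllipticCurve.Affine.Point
import Mathlib.NumberTheory.NumberField.AdeleRing
import Mathlib.NumberTheory.Padics.PadicNumbers
import Mathlib.Analysis.RCLike.Basic
import HarnessLib

/-!
# Divisibility of a rational point over an extension field; local halvability `P ∈ 2·E(ℚ_v)`

Topic `NumberTheory/EllipticCurves`.  Definitions with bodies and small API only — **no named fact** (D-0026).
All declarations are deliberate dot-notation extensions in `namespace WeierstrassCurve` (as `Literature/…/Selmer.lean`).

For a Weierstrass curve `W` over a field `F`, a point `P ∈ E(F)`, an extension field `L ⊇ F` (`[Algebra F L]`) and `n : ℕ`,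
`W.IsDivisibleOver L n P` says **`P ∈ n·E(L)`**: the image of `P` under Mathlib's base-change map
`WeierstrassCurve.Affine.Point.baseChange F L : E(F) →+ E(L)` is `n • Q` for some `Q ∈ E(L)`.  As in Mathlib's `Affine.Point.map` /
`Affine.Point.baseChange` API, the type of `F`-points is written `(W.baseChange F).toAffine.Point` (Mathlib's `W⟮F⟯`); it is
DEFINITIONALLY `W.toAffine.Point` (`W.baseChange F = W.map (RingHom.id F)` reduces to `W` by structure eta), so a point
`P : W.toAffine.Point` may be passed directly (checked in the typer's scratch; rewriting lemmas are stated in the `W⟮F⟯` form so that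
`map_zero` / `map_nsmul` / `map_add` apply syntactically).  Mathlib's group law on `Affine.Point` takes a `DecidableEq` instance on the
field; the general lemmas are stated over `[DecidableEq F] [DecidableEq L]` so that they specialise to `ℚ` (decidable) and to `ℚ_p`, `ℝ`,
completions (classical, `open scoped Classical` in those sections) with the SAME instances the users' terms carry.  Specialisations (the vocabulary of
`2`-descent over a quadratic field — Kramer 1981, Prop. 7: at a prime `q` ramified in `K/ℚ` where `E` has good reduction the norm
group is `N E(K_w) = 2E(ℚ_q)`; at a real place becoming complex `N E(ℂ) = E⁰(ℝ) = 2E(ℝ) + …` — asked for by cell `bsd-f1-sign2`,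
-desc §29-add3, as «the generator is locally halvable at the door»):
* `W.LocallyDivisibleAt n P v` / `W.LocallyDivisibleAtInfinitePlace n P w` for a number field `K`, `v : HeightOneSpectrum (𝓞 K)`
  (completion `v.adicCompletion K`) and `w : InfinitePlace K` (completion `w.Completion`) — the place indexing of `Selmer.lean`;
* over `ℚ`: `W.LocallyHalvableAtPrime P p := P ∈ 2·E(ℚ_p)` (`Padic`), `W.LocallyHalvableAtReal P := P ∈ 2·E(ℝ)`.
API: `0` is divisible, `n • Q` is divisible, sums of divisible points are divisible, divisibility persists along `F`-algebra maps
`L →ₐ[F] L'` (`IsDivisibleOver.map`).  NOT here: the equivalence with the vanishing of the local Kummer class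
`κ_v(P) ∈ H¹(F_v, E[n])` (exactness of the local Kummer sequence, `LocalKummerMap.lean`), and any computation of `E(ℚ_p)/2`.
-/

noncomputable section

namespace WeierstrassCurve

universe u v w

section General

variable {F : Type u} [Field F] [DecidableEq F] (W : WeierstrassCurve F) (L : Type v) [Field L] [DecidableEq L]
  [Algebra F L]

/-- **`P ∈ n·E(L)`**: the `F`-rational point `P` of `W / F` becomes divisible by `n` in the Mordell–Weil group `E(L)` of the
extension field `L` of `F` — `∃ Q ∈ E(L), n • Q = P` (the image of `P` under `WeierstrassCurve.Affine.Point.baseChange F L`).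
Deliberate dot-notation extension of Mathlib's `WeierstrassCurve`.
[cite: SilvermanAEC2009, §VIII.1, Lemma 1.1.1 (the kernel `(E(K) ∩ mE(L))/mE(K)`, `[m]Q_P = P` with `Q_P ∈ E(L)`)] -/
def IsDivisibleOver (n : ℕ) (P : (W.baseChange F).toAffine.Point) : Prop :=
  ∃ Q : (W.baseChange L).toAffine.Point, n • Q = Affine.Point.baseChange F L (W' := W) P

variable {W L}

/-- Unfolding of `IsDivisibleOver`. [cite: SilvermanAEC2009, §VIII.1, Lemma 1.1.1 (the kernel `(E(K) ∩ mE(L))/mE(K)`, `[m]Q_P = P` with `Q_P ∈ E(L)`)] -/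
theorem isDivisibleOver_iff (n : ℕ) (P : (W.baseChange F).toAffine.Point) :
    W.IsDivisibleOver L n P ↔
      ∃ Q : (W.baseChange L).toAffine.Point, n • Q = Affine.Point.baseChange F L (W' := W) P :=
  Iff.rfl

/-- `O ∈ n·E(L)`. [cite: SilvermanAEC2009, §VIII.1, Lemma 1.1.1 (the kernel `(E(K) ∩ mE(L))/mE(K)`, `[m]Q_P = P` with `Q_P ∈ E(L)`)] -/
theorem isDivisibleOver_zero (n : ℕ) : W.IsDivisibleOver L n 0 :=
  ⟨0, by rw [smul_zero, map_zero]⟩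

/-- A point already divisible by `n` over `F` is divisible by `n` over every extension. [cite: SilvermanAEC2009, §VIII.1, Lemma 1.1.1 (the kernel `(E(K) ∩ mE(L))/mE(K)`, `[m]Q_P = P` with `Q_P ∈ E(L)`)] -/
theorem isDivisibleOver_nsmul (n : ℕ) (Q : (W.baseChange F).toAffine.Point) : W.IsDivisibleOver L n (n • Q) :=
  ⟨Affine.Point.baseChange F L (W' := W) Q, by rw [map_nsmul]⟩

/-- Every point is `1`-divisible. [cite: SilvermanAEC2009, §VIII.1, Lemma 1.1.1 (the kernel `(E(K) ∩ mE(L))/mE(K)`, `[m]Q_P = P` with `Q_P ∈ E(L)`)] -/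
theorem isDivisibleOver_one (P : (W.baseChange F).toAffine.Point) : W.IsDivisibleOver L 1 P :=
  ⟨Affine.Point.baseChange F L (W' := W) P, by rw [one_smul]⟩

/-- `n·E(L) ∩ E(F)` is closed under addition. [cite: SilvermanAEC2009, §VIII.1, Lemma 1.1.1 (the kernel `(E(K) ∩ mE(L))/mE(K)`, `[m]Q_P = P` with `Q_P ∈ E(L)`)] -/
theorem IsDivisibleOver.add {n : ℕ} {P₁ P₂ : (W.baseChange F).toAffine.Point} (h₁ : W.IsDivisibleOver L n P₁)
    (h₂ : W.IsDivisibleOver L n P₂) : W.IsDivisibleOver L n (P₁ + P₂) := by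
  obtain ⟨Q₁, hQ₁⟩ := h₁
  obtain ⟨Q₂, hQ₂⟩ := h₂
  exact ⟨Q₁ + Q₂, by rw [smul_add, hQ₁, hQ₂, map_add]⟩

/-- … and under negation. [cite: SilvermanAEC2009, §VIII.1, Lemma 1.1.1 (the kernel `(E(K) ∩ mE(L))/mE(K)`, `[m]Q_P = P` with `Q_P ∈ E(L)`)] -/
theorem IsDivisibleOver.neg {n : ℕ} {P : (W.baseChange F).toAffine.Point} (h : W.IsDivisibleOver L n P) :
    W.IsDivisibleOver L n (-P) := by
  obtain ⟨Q, hQ⟩ := h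
  exact ⟨-Q, by rw [smul_neg, hQ, map_neg]⟩

/-- Divisibility persists along `F`-algebra maps of extension fields `L →ₐ[F] L'` (e.g. `K ↪ K_v`): `P ∈ n·E(L) ⟹ P ∈ n·E(L')`.
[cite: SilvermanAEC2009, §VIII.1, Lemma 1.1.1 (the kernel `(E(K) ∩ mE(L))/mE(K)`, `[m]Q_P = P` with `Q_P ∈ E(L)`)] -/
theorem IsDivisibleOver.map {L' : Type w} [Field L'] [DecidableEq L'] [Algebra F L'] (f : L →ₐ[F] L') {n : ℕ}
    {P : (W.baseChange F).toAffine.Point} (h : W.IsDivisibleOver L n P) : W.IsDivisibleOver L' n P := by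
  obtain ⟨Q, hQ⟩ := h
  refine ⟨Affine.Point.map (W' := W) f Q, ?_⟩
  rw [← map_nsmul, hQ, Affine.Point.map_baseChange]

end General

section Places

open NumberField IsDedekindDomain
open scoped Classical

variable {K : Type u} [Field K] [NumberField K] (W : WeierstrassCurve K)

/-- **`P ∈ n·E(K_v)` at a finite place** `v` of the number field `K` (`K_v = v.adicCompletion K`, the indexing of
`WeierstrassCurve.selmerGroup`). [cite: SilvermanAEC2009, §VIII.1, Lemma 1.1.1 and §X.4 (local condition `E(K_v)/mE(K_v)`)] -/
abbrev LocallyDivisibleAt (n : ℕ) (P : (W.baseChange K).toAffine.Point) (v : HeightOneSpectrum (𝓞 K)) : Prop :=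
  W.IsDivisibleOver (v.adicCompletion K) n P

/-- **`P ∈ n·E(K_w)` at an infinite place** `w` of `K` (`K_w = w.Completion ≅ ℝ` or `ℂ`). [cite: SilvermanAEC2009, §VIII.1, Lemma 1.1.1 and §X.4 (local condition `E(K_v)/mE(K_v)`)] -/
abbrev LocallyDivisibleAtInfinitePlace (n : ℕ) (P : (W.baseChange K).toAffine.Point) (w : InfinitePlace K) : Prop :=
  W.IsDivisibleOver w.Completion n P

end Places

section Rat

open scoped Classical

variable (W : WeierstrassCurve ℚ)

/-- **«`P` is locally halvable at the prime `p`»: `P ∈ 2·E(ℚ_p)`** (Mathlib's `Padic` `ℚ_[p]`).  In `2`-descent over a quadratic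
field `K` ramified at a prime `p` of good reduction this is the norm condition `P ∈ N E(K_𝔭) = 2E(ℚ_p)` (Kramer 1981, Prop. 7); it
holds automatically when `#Ẽ(𝔽_p)` is odd.
[cite: SilvermanAEC2009, §VIII.1, Lemma 1.1.1 and §X.4 (local condition `E(K_v)/mE(K_v)`)] [cite: Kramer1981, Prop. 7] -/
abbrev LocallyHalvableAtPrime (P : (W.baseChange ℚ).toAffine.Point) (p : ℕ) [Fact p.Prime] : Prop :=
  W.IsDivisibleOver ℚ_[p] 2 P

/-- **«`P` is locally halvable at `∞`»: `P ∈ 2·E(ℝ)`** (for `Δ < 0`, `E(ℝ) ≅ ℝ/ℤ` is `2`-divisible and this always holds; for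
`Δ > 0` it says `P` lies on the identity component `E⁰(ℝ)`).
[cite: SilvermanAEC2009, §VIII.1, Lemma 1.1.1 and §X.4 (local condition `E(K_v)/mE(K_v)`)] [cite: Kramer1981, Prop. 7] -/
abbrev LocallyHalvableAtReal (P : (W.baseChange ℚ).toAffine.Point) : Prop :=
  W.IsDivisibleOver ℝ 2 P

/-- The `ℚ`-points of `W` in the tree's currency `W.toAffine.Point` are accepted as they stand (the two point types agree
definitionally): `O ∈ 2·E(ℚ_p)`. [cite: SilvermanAEC2009, §VIII.1, Lemma 1.1.1 and §X.4 (local condition `E(K_v)/mE(K_v)`)] -/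
theorem locallyHalvableAtPrime_zero (p : ℕ) [Fact p.Prime] : W.LocallyHalvableAtPrime (0 : W.toAffine.Point) p :=
  isDivisibleOver_zero 2

/-- Unfolding: `W.LocallyHalvableAtPrime P p ↔ ∃ Q ∈ E(ℚ_p), 2 • Q = P`. [cite: SilvermanAEC2009, §VIII.1, Lemma 1.1.1 and §X.4 (local condition `E(K_v)/mE(K_v)`)] -/
theorem locallyHalvableAtPrime_iff (P : (W.baseChange ℚ).toAffine.Point) (p : ℕ) [Fact p.Prime] :
    W.LocallyHalvableAtPrime P p ↔
      ∃ Q : (W.baseChange ℚ_[p]).toAffine.Point, 2 • Q = Affine.Point.baseChange ℚ ℚ_[p] (W' := W) P :=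
  Iff.rfl

/-- A point of the form `2 • Q`, `Q ∈ E(ℚ)`, is locally halvable at every prime. [cite: SilvermanAEC2009, §VIII.1, Lemma 1.1.1 and §X.4 (local condition `E(K_v)/mE(K_v)`)] -/
theorem locallyHalvableAtPrime_two_nsmul (Q : (W.baseChange ℚ).toAffine.Point) (p : ℕ) [Fact p.Prime] :
    W.LocallyHalvableAtPrime ((2 : ℕ) • Q) p :=
  isDivisibleOver_nsmul 2 Q

/-- … and at the real place. [cite: SilvermanAEC2009, §VIII.1, Lemma 1.1.1 and §X.4 (local condition `E(K_v)/mE(K_v)`)] -/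
theorem locallyHalvableAtReal_two_nsmul (Q : (W.baseChange ℚ).toAffine.Point) : W.LocallyHalvableAtReal ((2 : ℕ) • Q) :=
  isDivisibleOver_nsmul 2 Q

end Rat

end WeierstrassCurve

end
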